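import Literature.Topology.FourManifolds.CreaseStage
import Literature.Topology.FourManifolds.ImmersionChart
import Literature.Topology.FourManifolds.CofacePair
import Mathlib.Geometry.Manifold.PartitionOfUnity
import Mathlib.Topology.MetricSpace.Thickening
import HarnessLib

/-!
# Construction of the crease normal form at a codimension-one cell

Topic `Literature/Topology/FourManifolds`; stage 1 (codimension one) of the downward sweep of the
smoothing of PD homeomorphisms (Munkres, Ann. of Math. 72 (1960), §§2–3; Campbell–D'Onofrio–Vítek
(2026), Lemma 3.1).  `CreaseStage.lean` smooths a map already in CREASE NORMAL FORM
(`IsCreaseNormalForm Θ Θ' u Glow V δ`); this file PRODUCES the normal form from the PL/smooth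
coordinate data of one codimension-one simplex `s` (a facet `facet b i₀` of an affine basis `b`
of the PL coordinate space `Q`) with its two top cofaces `insert p± s` (`CofacePair.lean`):

* the PD charts `f` (first structure) and `h` (second structure) on an open `O ⊇ core`, injective,
  continuous, `f` open, agreeing with `C^∞` models `fu`/`fl`, `ku`/`kl` (injective derivative)
  on `O ∩ conv (insert p± s)`; the current map `u` with `u (f x) = h x` on `O`;
* an affine parametrisation `A (x, σ) = a₀ + Alin (x, σ)` of `Q` by `E × ℝ` whose height
  `b.coord i₀ ∘ A` is `c σ`, with the compact parameter set `KV ⊇ V` mapped at height `0` into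
  the relative interior of `s` (facet coordinates `≥ m₀ > 0`).

`exists_creaseNormalForm` then gives `Θ = ef ∘ A`, `Θ' = eh ∘ A` (immersion charts of `fu`, `ku`
about the core, `ImmersionChart.lean`), the lower model `Glow` (globalisation of
`Θ'.symm ∘ kl ∘ efl.symm ∘ Θ`) and `δ > 0` with `IsCreaseNormalForm Θ Θ' u Glow V δ`, together
with the smoothness of `Θ^{±1}`, `Θ'^{±1}` required by `IsCreaseNormalForm.exists_stage`, and two
location facts used by the sweep (points of the box over `KV` map into `O` and are `f`-images of
points of `O` lying in one of the two cofaces; upper box points map into the upper coface;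
the box over `KV` lies in both chart sources; and the FACE FORMULA of the derivative of `Glow` at
`(x, 0)`, `x ∈ KV`, as the chain of the model derivatives — margin-free data for the sweep).  The
proof is a chain of uniform choices (thickenings of the compact core inside the chart sources,
the uniform half-ball lemma, uniform continuity on compact thickenings) and two injectivity
arguments deciding on which side of the facet the relevant preimages lie.

Also: `exists_contDiff_eqOn_of_isCompact_of_finiteDimensional`, globalisation of a `C^∞` map
near a compact set in any finite-dimensional space (the tree's version is for `ℝⁿ`).

Everything is proved; no definitions; no named facts.

## References

* J. R. Munkres, *Obstructions to the smoothing of piecewise-differentiable homeomorphisms*, Ann.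
  of Math. (2) 72 (1960), 521–554, §§2–3. [Munkres1960]
* D. Campbell, L. D'Onofrio, T. Vítek, *Diffeomorphic approximation of piecewise affine
  homeomorphisms*, J. Geom. Anal. 36 (2026), Lemma 3.1. [CampbellDonofrioVitek2026]
-/

noncomputable section

open Set Function Metric Filter
open scoped Topology ContDiff Manifold

namespace Literature.Topology.FourManifolds

/-! ### Globalisation near a compact set (finite-dimensional spaces) -/

section Global

variable {P : Type*} [NormedAddCommGroup P] [NormedSpace ℝ P] [FiniteDimensional ℝ P]
variable {P' : Type*} [NormedAddCommGroup P'] [NormedSpace ℝ P']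

/-- **Globalisation near a compact set.** A `C^∞` map on an open set `U` of a finite-dimensional
space agrees, on an open neighbourhood (inside `U`) of any compact `C ⊆ U`, with a globally `C^∞`
map. [folklore] -/
theorem exists_contDiff_eqOn_of_isCompact_of_finiteDimensional {U : Set P} (hU : IsOpen U)
    {h : P → P'} (hh : ContDiffOn ℝ ∞ h U) {C : Set P} (hC : IsCompact C) (hCU : C ⊆ U) :
    ∃ g : P → P', ContDiff ℝ ∞ g ∧ ∃ V : Set P, IsOpen V ∧ C ⊆ V ∧ V ⊆ U ∧ EqOn g h V := by
  obtain ⟨L, hL, hCL, hLU⟩ := exists_compact_between hC hU hCU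
  obtain ⟨θ, h1, h0, -⟩ :=
    exists_contMDiffMap_one_nhds_of_subset_interior (𝓘(ℝ, P)) (n := ⊤) hC.isClosed hCL
  have hθ : ContDiff ℝ ∞ θ := contMDiff_iff_contDiff.1 θ.contMDiff
  obtain ⟨V, hVo, hCV, hV1⟩ : ∃ V : Set P, IsOpen V ∧ C ⊆ V ∧ ∀ x ∈ V, θ x = 1 := by
    obtain ⟨V, hVo, hCV, hsub⟩ := mem_nhdsSet_iff_exists.1 h1
    exact ⟨V, hVo, hCV, fun x hx => hsub hx⟩
  refine ⟨fun x => θ x • h x, ?_, V ∩ U, hVo.inter hU, subset_inter hCV hCU, inter_subset_right,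
    fun x hx => ?_⟩
  · rw [contDiff_iff_contDiffAt]
    intro x
    by_cases hx : x ∈ U
    · exact hθ.contDiffAt.smul (hh.contDiffAt (hU.mem_nhds hx))
    · have hxL : x ∉ L := fun h' => hx (hLU h')
      have hev : (fun y => θ y • h y) =ᶠ[𝓝 x] fun _ => 0 := by
        filter_upwards [hL.isClosed.isOpen_compl.mem_nhds hxL] with y hy
        rw [h0 y hy, zero_smul]
      exact (contDiffAt_const (c := (0 : P'))).congr_of_eventuallyEq hev
  · show θ x • h x = h x
    rw [hV1 x hx.1, one_smul]

end Global

/-! ### The construction -/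

section Construction

variable {E : Type*} [NormedAddCommGroup E] [NormedSpace ℝ E] [FiniteDimensional ℝ E]
variable {Q : Type*} [NormedAddCommGroup Q] [NormedSpace ℝ Q] [FiniteDimensional ℝ Q]
  [DecidableEq Q]
variable {ι : Type*} [Fintype ι] [DecidableEq ι]

omit [FiniteDimensional ℝ Q] [DecidableEq Q] in
/-- **A chart inverse has an invertible derivative.** If `e = g` is `C^∞` with `C^∞` inverse on
the target, then at a point `e q` of the target `e.symm` has an invertible derivative.
[folklore] -/
theorem exists_hasFDerivAt_symm_equiv (e : OpenPartialHomeomorph Q Q) {g : Q → Q} (heg : ⇑e = g)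
    (hg : ContDiff ℝ ∞ g) (hes : ContDiffOn ℝ ∞ e.symm e.target) {q : Q} (hq : q ∈ e.source) :
    ∃ L : Q ≃L[ℝ] Q, HasFDerivAt g (L : Q →L[ℝ] Q) q ∧
      HasFDerivAt e.symm (L.symm : Q →L[ℝ] Q) (g q) := by
  have hΘ : ContDiffOn ℝ ∞ e e.source := by rw [heg]; exact hg.contDiffOn
  obtain ⟨L, hL, hLs⟩ := exists_hasFDerivAt_equiv_of_symm e hΘ hes hq
  exact ⟨L, by rwa [heg] at hL, by rwa [heg] at hLs⟩

omit [FiniteDimensional ℝ E] [NormedSpace ℝ Q] [FiniteDimensional ℝ Q] [DecidableEq Q] in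
/-- **Shrinking the width** of a crease normal form. [folklore] -/
theorem IsCreaseNormalForm.mono {Θ Θ' : OpenPartialHomeomorph (E × ℝ) Q} {u : Q → Q}
    {Glow : E × ℝ → E × ℝ} {V : Set E} {δ δ' : ℝ} (h : IsCreaseNormalForm Θ Θ' u Glow V δ)
    (hδ' : 0 < δ') (hle : δ' ≤ δ) : IsCreaseNormalForm Θ Θ' u Glow V δ' where
  isOpen := h.isOpen
  pos := hδ'
  source p hp1 hp2 := h.source p hp1 (hp2.trans_le hle)
  source' p hp1 hp2 := h.source' p hp1 (hp2.trans_le hle)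
  up p hp1 hp2 hp3 := h.up p hp1 hp2 (hp3.trans_le hle)
  low_mem p hp1 hp2 hp3 := h.low_mem p hp1 (by linarith) hp3
  low p hp1 hp2 hp3 := h.low p hp1 (by linarith) hp3
  injOn := h.injOn.mono fun p hp => (⟨hp.1, hp.2.trans_le hle⟩ : p.1 ∈ V ∧ |p.2| < δ)
  glow_contDiff := h.glow_contDiff
  glow_deriv p hp1 hp2 hp3 := h.glow_deriv p hp1 (by linarith) hp3

omit [FiniteDimensional ℝ E] [NormedSpace ℝ Q] [FiniteDimensional ℝ Q] [DecidableEq Q] in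
/-- **Shrinking the base** of a crease normal form to an open subset. [folklore] -/
theorem IsCreaseNormalForm.subset {Θ Θ' : OpenPartialHomeomorph (E × ℝ) Q} {u : Q → Q}
    {Glow : E × ℝ → E × ℝ} {V V' : Set E} {δ : ℝ} (h : IsCreaseNormalForm Θ Θ' u Glow V δ)
    (hV'o : IsOpen V') (hV' : V' ⊆ V) : IsCreaseNormalForm Θ Θ' u Glow V' δ where
  isOpen := hV'o
  pos := h.pos
  source p hp1 hp2 := h.source p (hV' hp1) hp2
  source' p hp1 hp2 := h.source' p (hV' hp1) hp2
  up p hp1 hp2 hp3 := h.up p (hV' hp1) hp2 hp3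
  low_mem p hp1 hp2 hp3 := h.low_mem p (hV' hp1) hp2 hp3
  low p hp1 hp2 hp3 := h.low p (hV' hp1) hp2 hp3
  injOn := h.injOn.mono fun p hp => (⟨hV' hp.1, hp.2⟩ : p.1 ∈ V ∧ |p.2| < δ)
  glow_contDiff := h.glow_contDiff
  glow_deriv p hp1 hp2 hp3 := h.glow_deriv p (hV' hp1) hp2 hp3

/-- **Construction of the crease normal form** (see the module docstring for the setting and the
meaning of the hypotheses). [cite: Munkres1960, §2–§3; CampbellDonofrioVitek2026, Lemma 3.1] -/
theorem exists_creaseNormalForm (b : AffineBasis ι ℝ Q) (i₀ : ι) {pu pl : Q}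
    (hpu : 0 < b.coord i₀ pu) (hpl : b.coord i₀ pl < 0) (Alin : (E × ℝ) ≃L[ℝ] Q) (a₀ : Q)
    {c : ℝ} (hc : 0 < c) (hA : ∀ p : E × ℝ, b.coord i₀ (a₀ + Alin p) = c * p.2)
    {V KV : Set E} (hVo : IsOpen V) (hKV : IsCompact KV) (hVK : V ⊆ KV) {m₀ : ℝ} (hm₀ : 0 < m₀)
    (hmargin : ∀ x ∈ KV, ∀ i, i ≠ i₀ → m₀ ≤ b.coord i (a₀ + Alin (x, 0)))
    {fu fl ku kl : Q → Q} (hfu : ContDiff ℝ ∞ fu) (hfl : ContDiff ℝ ∞ fl) (hku : ContDiff ℝ ∞ ku)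
    (hkl : ContDiff ℝ ∞ kl)
    (hDfu : ∀ x ∈ convexHull ℝ ((insert pu (facet b i₀) : Finset Q) : Set Q),
      Injective (fderiv ℝ fu x))
    (hDfl : ∀ x ∈ convexHull ℝ ((insert pl (facet b i₀) : Finset Q) : Set Q),
      Injective (fderiv ℝ fl x))
    (hDku : ∀ x ∈ convexHull ℝ ((insert pu (facet b i₀) : Finset Q) : Set Q),
      Injective (fderiv ℝ ku x))
    (hDkl : ∀ x ∈ convexHull ℝ ((insert pl (facet b i₀) : Finset Q) : Set Q),
      Injective (fderiv ℝ kl x))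
    {f h u : Q → Q} {O : Set Q} (hO : IsOpen O) (hcoreO : ∀ x ∈ KV, a₀ + Alin (x, 0) ∈ O)
    (hfc : ContinuousOn f O) (hhc : ContinuousOn h O) (hfinj : InjOn f O) (hhinj : InjOn h O)
    (hfopen : ∀ N : Set Q, IsOpen N → N ⊆ O → IsOpen (f '' N))
    (hffu : ∀ x ∈ O, x ∈ convexHull ℝ ((insert pu (facet b i₀) : Finset Q) : Set Q) → f x = fu x)
    (hffl : ∀ x ∈ O, x ∈ convexHull ℝ ((insert pl (facet b i₀) : Finset Q) : Set Q) → f x = fl x)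
    (hhku : ∀ x ∈ O, x ∈ convexHull ℝ ((insert pu (facet b i₀) : Finset Q) : Set Q) → h x = ku x)
    (hhkl : ∀ x ∈ O, x ∈ convexHull ℝ ((insert pl (facet b i₀) : Finset Q) : Set Q) → h x = kl x)
    (huf : ∀ x ∈ O, u (f x) = h x) :
    ∃ (Θ Θ' : OpenPartialHomeomorph (E × ℝ) Q) (Glow : E × ℝ → E × ℝ) (δ : ℝ),
      IsCreaseNormalForm Θ Θ' u Glow V δ ∧
      ContDiffOn ℝ ∞ Θ Θ.source ∧ ContDiffOn ℝ ∞ Θ.symm Θ.target ∧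
      ContDiffOn ℝ ∞ Θ' Θ'.source ∧ ContDiffOn ℝ ∞ Θ'.symm Θ'.target ∧
      (∀ p, Θ p = fu (a₀ + Alin p)) ∧ (∀ p, Θ' p = ku (a₀ + Alin p)) ∧
      (∀ p : E × ℝ, p.1 ∈ KV → |p.2| < δ →
        a₀ + Alin p ∈ O ∧ ∃ q ∈ O,
          (q ∈ convexHull ℝ ((insert pu (facet b i₀) : Finset Q) : Set Q) ∨
            q ∈ convexHull ℝ ((insert pl (facet b i₀) : Finset Q) : Set Q)) ∧
          f q = fu (a₀ + Alin p)) ∧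
      (∀ p : E × ℝ, p.1 ∈ KV → 0 ≤ p.2 → p.2 < δ →
        a₀ + Alin p ∈ convexHull ℝ ((insert pu (facet b i₀) : Finset Q) : Set Q)) ∧
      (∀ p : E × ℝ, p.1 ∈ KV → |p.2| < δ → p ∈ Θ.source ∧ p ∈ Θ'.source) ∧
      (∀ x ∈ KV, ∃ L₁ L₂ L₃ L₄ : Q ≃L[ℝ] Q,
        (L₁ : Q →L[ℝ] Q) = fderiv ℝ fu (a₀ + Alin (x, 0)) ∧
        (L₂ : Q →L[ℝ] Q) = fderiv ℝ fl (a₀ + Alin (x, 0)) ∧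
        (L₃ : Q →L[ℝ] Q) = fderiv ℝ kl (a₀ + Alin (x, 0)) ∧
        (L₄ : Q →L[ℝ] Q) = fderiv ℝ ku (a₀ + Alin (x, 0)) ∧
        HasFDerivAt Glow ((Alin.symm : Q →L[ℝ] E × ℝ).comp ((L₄.symm : Q →L[ℝ] Q).comp
          ((L₃ : Q →L[ℝ] Q).comp ((L₂.symm : Q →L[ℝ] Q).comp ((L₁ : Q →L[ℝ] Q).comp
            (Alin : (E × ℝ) →L[ℝ] Q)))))) (x, 0)) := by
  -- ### the affine parametrisation
  set A : E × ℝ → Q := fun p => a₀ + Alin p with hA_def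
  set AH : (E × ℝ) ≃ₜ Q := Alin.toHomeomorph.trans (Homeomorph.addLeft a₀) with hAH
  have hAHapply : ∀ p, AH p = A p := fun p => rfl
  have hAHsymm : ∀ q, A (AH.symm q) = q := fun q => by rw [← hAHapply, AH.apply_symm_apply]
  have hA2 : ∀ p : E × ℝ, p.2 = c⁻¹ * b.coord i₀ (A p) := fun p => by
    rw [hA p]; field_simp
  have hAsymm2 : ∀ q, (AH.symm q).2 = c⁻¹ * b.coord i₀ q := fun q => by
    rw [hA2, hAHsymm]
  have hAdist : ∀ (x : E) (σ : ℝ), dist (A (x, σ)) (A (x, 0)) ≤ ‖(Alin : (E × ℝ) →L[ℝ] Q)‖ * |σ| :=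
    fun x σ => by
    rw [dist_eq_norm]
    have : A (x, σ) - A (x, 0) = Alin ((0 : E), σ) := by
      simp only [hA_def]
      rw [add_sub_add_left_eq_sub, ← map_sub, Prod.mk_sub_mk, sub_self, sub_zero]
    rw [this]
    calc ‖Alin ((0 : E), σ)‖ ≤ ‖(Alin : (E × ℝ) →L[ℝ] Q)‖ * ‖((0 : E), σ)‖ := Alin.toContinuousLinearMap.le_opNorm _
      _ = ‖(Alin : (E × ℝ) →L[ℝ] Q)‖ * |σ| := by simp [Prod.norm_def]
  have hAcont : Continuous A := by simp only [hA_def]; fun_prop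
  have hAderiv : ∀ p, HasFDerivAt A (Alin : (E × ℝ) →L[ℝ] Q) p := fun p => by
    simpa [hA_def] using (Alin.toContinuousLinearMap.hasFDerivAt (x := p)).const_add a₀
  have hAsymm_deriv : ∀ q, HasFDerivAt AH.symm (Alin.symm : Q →L[ℝ] E × ℝ) q := fun q => by
    have : (AH.symm : Q → E × ℝ) = fun q => Alin.symm (q - a₀) := by
      ext1 q
      apply AH.injective
      rw [AH.apply_symm_apply, hAHapply]
      simp [hA_def]
    rw [this]
    have h1 : HasFDerivAt (fun q : Q => q - a₀) (ContinuousLinearMap.id ℝ Q) q :=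
      (hasFDerivAt_id q).sub_const a₀
    have h2 : HasFDerivAt (fun q : Q => Alin.symm (q - a₀))
        ((Alin.symm : Q →L[ℝ] E × ℝ).comp (ContinuousLinearMap.id ℝ Q)) q :=
      (Alin.symm.toContinuousLinearMap.hasFDerivAt).comp q h1
    rwa [ContinuousLinearMap.comp_id] at h2
  -- ### the core
  set C : Set Q := (fun x : E => A (x, 0)) '' KV with hC_def
  have hCc : IsCompact C := hKV.image (by simp only [hA_def]; fun_prop)
  have hCO : C ⊆ O := by rintro _ ⟨x, hx, rfl⟩; exact hcoreO x hx
  have hcore0 : ∀ x ∈ KV, b.coord i₀ (A (x, 0)) = 0 := fun x _ => by rw [hA]; simp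
  -- the uniform half-balls
  obtain ⟨δu, hδu, hballu⟩ := mem_convexHull_insert_of_coord_uniform b i₀ hm₀ hpu.ne'
  obtain ⟨δl, hδl, hballl⟩ := mem_convexHull_insert_of_coord_uniform b i₀ hm₀ hpl.ne
  have hup_of : ∀ x ∈ KV, ∀ y, dist y (A (x, 0)) < δu → 0 ≤ b.coord i₀ y →
      y ∈ convexHull ℝ ((insert pu (facet b i₀) : Finset Q) : Set Q) :=
    fun x hx y hy hs => hballu _ (hcore0 x hx) (hmargin x hx) y hy (div_nonneg hs hpu.le)
  have hlow_of : ∀ x ∈ KV, ∀ y, dist y (A (x, 0)) < δl → b.coord i₀ y ≤ 0 →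
      y ∈ convexHull ℝ ((insert pl (facet b i₀) : Finset Q) : Set Q) :=
    fun x hx y hy hs => hballl _ (hcore0 x hx) (hmargin x hx) y hy
      (div_nonneg_of_nonpos hs hpl.le)
  have hCtu : C ⊆ convexHull ℝ ((insert pu (facet b i₀) : Finset Q) : Set Q) := by
    rintro _ ⟨x, hx, rfl⟩
    exact hup_of x hx _ (by rw [dist_self]; exact hδu) (hcore0 x hx).ge
  have hCtl : C ⊆ convexHull ℝ ((insert pl (facet b i₀) : Finset Q) : Set Q) := by
    rintro _ ⟨x, hx, rfl⟩
    exact hlow_of x hx _ (by rw [dist_self]; exact hδl) (hcore0 x hx).le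
  -- ### the immersion charts
  have hinj_fu : InjOn fu C := fun z hz z' hz' heq => by
    have h1 := hffu z (hCO hz) (hCtu hz); have h2 := hffu z' (hCO hz') (hCtu hz')
    exact hfinj (hCO hz) (hCO hz') (by rw [h1, h2, heq])
  have hinj_fl : InjOn fl C := fun z hz z' hz' heq => by
    have h1 := hffl z (hCO hz) (hCtl hz); have h2 := hffl z' (hCO hz') (hCtl hz')
    exact hfinj (hCO hz) (hCO hz') (by rw [h1, h2, heq])
  have hinj_ku : InjOn ku C := fun z hz z' hz' heq => by
    have h1 := hhku z (hCO hz) (hCtu hz); have h2 := hhku z' (hCO hz') (hCtu hz')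
    exact hhinj (hCO hz) (hCO hz') (by rw [h1, h2, heq])
  obtain ⟨ef, hef, hCef, hefs, hefd⟩ :=
    exists_openPartialHomeomorph_of_injOn_isCompact hfu hCc hinj_fu fun x hx => hDfu x (hCtu hx)
  obtain ⟨efl, hefl, hCefl, hefls, hefld⟩ :=
    exists_openPartialHomeomorph_of_injOn_isCompact hfl hCc hinj_fl fun x hx => hDfl x (hCtl hx)
  obtain ⟨eh, heh, hCeh, hehs, hehd⟩ :=
    exists_openPartialHomeomorph_of_injOn_isCompact hku hCc hinj_ku fun x hx => hDku x (hCtu hx)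
  -- ### uniform choices
  -- (1) a thickening of the core inside all sources and `O`
  set U₀ : Set Q := ef.source ∩ efl.source ∩ eh.source ∩ O with hU₀
  have hU₀o : IsOpen U₀ := ((ef.open_source.inter efl.open_source).inter eh.open_source).inter hO
  have hCU₀ : C ⊆ U₀ := fun z hz => ⟨⟨⟨hCef hz, hCefl hz⟩, hCeh hz⟩, hCO hz⟩
  obtain ⟨ρ₁, hρ₁, hthick₁⟩ := hCc.exists_cthickening_subset_open hU₀o hCU₀
  set K₁ : Set Q := cthickening ρ₁ C with hK₁
  have hK₁c : IsCompact K₁ := hCc.cthickening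
  have hK₁U₀ : K₁ ⊆ U₀ := hthick₁
  -- (2) `eh.target` contains a compact thickening of `eh '' C`; uniform continuity of `eh.symm`
  have hehC : IsCompact (eh '' C) := hCc.image_of_continuousOn (eh.continuousOn.mono hCeh)
  obtain ⟨ρ₄, hρ₄, hthick₄⟩ :=
    hehC.exists_cthickening_subset_open eh.open_target (image_subset_iff.2 fun z hz => eh.map_source (hCeh hz))
  set K₄ : Set Q := cthickening ρ₄ (eh '' C) with hK₄
  have hK₄c : IsCompact K₄ := hehC.cthickening
  set ε₅ : ℝ := min δu (ρ₁ / 2) with hε₅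
  have hε₅0 : 0 < ε₅ := by positivity
  obtain ⟨ω₅, hω₅, hUC₅⟩ := Metric.uniformContinuousOn_iff.1
    (hK₄c.uniformContinuousOn_of_continuous (eh.continuousOn_symm.mono hthick₄)) ε₅ hε₅0
  -- (3) uniform continuity of `h` on `K₁`
  have hhK₁ : ContinuousOn h K₁ := hhc.mono (hK₁U₀.trans inter_subset_right)
  obtain ⟨ω₆, hω₆, hUC₆⟩ := Metric.uniformContinuousOn_iff.1
    (hK₁c.uniformContinuousOn_of_continuous hhK₁) (min ρ₄ ω₅) (by positivity)
  -- (4) the neighbourhood `N₀` of the core and the thickening of `f '' C` inside `f '' N₀`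
  set ρ₂ : ℝ := min (min (ρ₁ / 2) ω₆) (min δu δl) with hρ₂
  have hρ₂0 : 0 < ρ₂ := by positivity
  set N₀ : Set Q := thickening ρ₂ C with hN₀
  have hN₀K₁ : N₀ ⊆ K₁ := (thickening_mono (by
    rw [hρ₂]; linarith [min_le_left (min (ρ₁ / 2) ω₆) (min δu δl), min_le_left (ρ₁ / 2) ω₆]) C).trans
    (thickening_subset_cthickening _ _)
  have hN₀O : N₀ ⊆ O := hN₀K₁.trans (hK₁U₀.trans inter_subset_right)
  have hfN₀ : IsOpen (f '' N₀) := hfopen N₀ isOpen_thickening hN₀O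
  have hfC : IsCompact (f '' C) := hCc.image_of_continuousOn (hfc.mono hCO)
  obtain ⟨ρ₃, hρ₃, hthick₃⟩ := hfC.exists_thickening_subset_open hfN₀
    (image_mono (self_subset_thickening hρ₂0 C))
  -- (5) uniform continuity of `fu ∘ A` in the normal direction
  obtain ⟨τ, hτ, hτclose⟩ : ∃ τ > 0, ∀ x ∈ KV, ∀ σ : ℝ, |σ| < τ →
      dist (fu (A (x, σ))) (fu (A (x, 0))) < ρ₃ := by
    have hcomp : IsCompact (KV ×ˢ Icc (-1 : ℝ) 1) := hKV.prod isCompact_Icc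
    have hcont : Continuous fun p : E × ℝ => fu (A p) := hfu.continuous.comp hAcont
    obtain ⟨τ, hτ, hU⟩ := Metric.uniformContinuousOn_iff.1
      (hcomp.uniformContinuousOn_of_continuous hcont.continuousOn) ρ₃ hρ₃
    refine ⟨min τ 1, by positivity, fun x hx σ hσ => ?_⟩
    have hσ1 : |σ| < 1 := hσ.trans_le (min_le_right _ _)
    refine hU (x, σ) ⟨hx, ?_⟩ (x, 0) ⟨hx, by simp⟩ ?_
    · rw [abs_lt] at hσ1; exact ⟨hσ1.1.le, hσ1.2.le⟩
    · rw [Prod.dist_eq, dist_self, Real.dist_eq, sub_zero, max_eq_right (abs_nonneg σ)]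
      exact hσ.trans_le (min_le_left _ _)
  -- (6) the raw width `δ₀`
  set nA : ℝ := ‖(Alin : (E × ℝ) →L[ℝ] Q)‖ + 1 with hnA
  have hnA0 : 0 < nA := by positivity
  set δ₀ : ℝ := min (ρ₂ / (2 * nA)) τ with hδ₀
  have hδ₀0 : 0 < δ₀ := by positivity
  -- ### consequences for points `A (x, σ)`, `x ∈ KV`, `|σ| < δ₀`
  -- (F1) such points are within `ρ₂ / 2` of the core, hence in `N₀ ⊆ K₁ ⊆ U₀`
  have hF1dist : ∀ x ∈ KV, ∀ σ : ℝ, |σ| < δ₀ → dist (A (x, σ)) (A (x, 0)) < ρ₂ / 2 := by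
    intro x hx σ hσ
    calc dist (A (x, σ)) (A (x, 0)) ≤ ‖(Alin : (E × ℝ) →L[ℝ] Q)‖ * |σ| := hAdist x σ
      _ ≤ nA * |σ| := by gcongr; rw [hnA]; linarith
      _ < nA * (ρ₂ / (2 * nA)) := by gcongr; exact hσ.trans_le (min_le_left _ _)
      _ = ρ₂ / 2 := by field_simp
  have hF1N₀ : ∀ x ∈ KV, ∀ σ : ℝ, |σ| < δ₀ → A (x, σ) ∈ N₀ := fun x hx σ hσ =>
    mem_thickening_iff.2 ⟨A (x, 0), ⟨x, hx, rfl⟩, by linarith [hF1dist x hx σ hσ]⟩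
  have hF1 : ∀ x ∈ KV, ∀ σ : ℝ, |σ| < δ₀ → A (x, σ) ∈ U₀ := fun x hx σ hσ =>
    hK₁U₀ (hN₀K₁ (hF1N₀ x hx σ hσ))
  -- (F2) `fu (A p) = f q` for some `q ∈ N₀` near a core point
  have hF2 : ∀ x ∈ KV, ∀ σ : ℝ, |σ| < δ₀ → ∃ q ∈ N₀, f q = fu (A (x, σ)) ∧
      ∃ x' ∈ KV, dist q (A (x', 0)) < ρ₂ := by
    intro x hx σ hσ
    have h1 : fu (A (x, σ)) ∈ thickening ρ₃ (f '' C) := by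
      refine mem_thickening_iff.2 ⟨fu (A (x, 0)), ⟨A (x, 0), ⟨x, hx, rfl⟩, ?_⟩, ?_⟩
      · exact hffu _ (hcoreO x hx) (hCtu ⟨x, hx, rfl⟩)
      · exact hτclose x hx σ (hσ.trans_le (min_le_right _ _))
    obtain ⟨q, hq, hfq⟩ := hthick₃ h1
    obtain ⟨z, ⟨x', hx', rfl⟩, hdist⟩ := mem_thickening_iff.1 hq
    exact ⟨q, hq, hfq, x', hx', hdist⟩
  -- (F3) side decision for such `q`
  have hF3u : ∀ x' ∈ KV, ∀ q, dist q (A (x', 0)) < ρ₂ → 0 ≤ b.coord i₀ q →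
      q ∈ convexHull ℝ ((insert pu (facet b i₀) : Finset Q) : Set Q) := fun x' hx' q hq hs =>
    hup_of x' hx' q (hq.trans_le ((min_le_right _ _).trans (min_le_left _ _))) hs
  have hF3l : ∀ x' ∈ KV, ∀ q, dist q (A (x', 0)) < ρ₂ → b.coord i₀ q ≤ 0 →
      q ∈ convexHull ℝ ((insert pl (facet b i₀) : Finset Q) : Set Q) := fun x' hx' q hq hs =>
    hlow_of x' hx' q (hq.trans_le ((min_le_right _ _).trans (min_le_right _ _))) hs
  -- (F5) for `σ ≤ 0` the preimage `q` lies on the lower side; the lower formulas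
  have hF5 : ∀ x ∈ KV, ∀ σ : ℝ, |σ| < δ₀ → σ ≤ 0 → ∃ q ∈ N₀, f q = fu (A (x, σ)) ∧
      b.coord i₀ q ≤ 0 ∧ q ∈ convexHull ℝ ((insert pl (facet b i₀) : Finset Q) : Set Q) ∧
      q ∈ efl.source ∧ efl.symm (fu (A (x, σ))) = q ∧ u (fu (A (x, σ))) = kl q ∧ h q = kl q ∧
      ∃ x' ∈ KV, dist q (A (x', 0)) < ρ₂ := by
    intro x hx σ hσ hσ0
    obtain ⟨q, hqN, hfq, x', hx', hdq⟩ := hF2 x hx σ hσ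
    have hqU₀ : q ∈ U₀ := hK₁U₀ (hN₀K₁ hqN)
    have hqO : q ∈ O := hqU₀.2
    -- the side of `q`
    have hside : b.coord i₀ q ≤ 0 := by
      by_contra hpos
      simp only [not_le] at hpos
      have hqtu := hF3u x' hx' q hdq hpos.le
      have h1 : fu q = fu (A (x, σ)) := by rw [← hffu q hqO hqtu, hfq]
      have h2 : q = A (x, σ) := by
        have hqs : q ∈ ef.source := hqU₀.1.1.1
        have hps : A (x, σ) ∈ ef.source := (hF1 x hx σ hσ).1.1.1
        exact ef.injOn hqs hps (by rw [hef]; exact h1)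
      have : b.coord i₀ q = c * σ := by rw [h2]; exact hA (x, σ)
      have : c * σ ≤ 0 := mul_nonpos_of_nonneg_of_nonpos hc.le hσ0
      linarith
    have hqtl := hF3l x' hx' q hdq hside
    have hflq : fl q = fu (A (x, σ)) := by rw [← hffl q hqO hqtl, hfq]
    have hqs : q ∈ efl.source := hqU₀.1.1.2
    have hsymm : efl.symm (fu (A (x, σ))) = q := by
      rw [← hflq, ← hefl]; exact efl.left_inv hqs
    have hu : u (fu (A (x, σ))) = kl q := by rw [← hfq, huf q hqO, hhkl q hqO hqtl]
    exact ⟨q, hqN, hfq, hside, hqtl, hqs, hsymm, hu, hhkl q hqO hqtl, x', hx', hdq⟩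
  -- (F6) `h q ∈ eh.target`, and the point `eh.symm (h q)` is on the lower side, in `U₀`
  have hF6 : ∀ x' ∈ KV, ∀ q ∈ N₀, dist q (A (x', 0)) < ρ₂ → b.coord i₀ q ≤ 0 →
      h q ∈ eh.target ∧ eh.symm (h q) ∈ U₀ ∧ b.coord i₀ (eh.symm (h q)) ≤ 0 := by
    intro x' hx' q hqN hdq hside
    have hqK₁ : q ∈ K₁ := hN₀K₁ hqN
    have hcK₁ : A (x', 0) ∈ K₁ := self_subset_cthickening C ⟨x', hx', rfl⟩
    have hqO : q ∈ O := (hK₁U₀ hqK₁).2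
    have hdh : dist (h q) (h (A (x', 0))) < min ρ₄ ω₅ :=
      hUC₆ q hqK₁ (A (x', 0)) hcK₁ (hdq.trans_le ((min_le_left _ _).trans (min_le_right _ _)))
    have hhc' : h (A (x', 0)) = eh (A (x', 0)) := by
      rw [heh]; exact hhku _ (hcoreO x' hx') (hCtu ⟨x', hx', rfl⟩)
    have hmemC : eh (A (x', 0)) ∈ eh '' C := ⟨A (x', 0), ⟨x', hx', rfl⟩, rfl⟩
    have hhqK₄ : h q ∈ K₄ := by
      refine mem_cthickening_of_dist_le _ (eh (A (x', 0))) _ _ hmemC ?_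
      rw [← hhc']; exact (hdh.trans_le (min_le_left _ _)).le
    have hcK₄ : eh (A (x', 0)) ∈ K₄ := self_subset_cthickening _ hmemC
    have htarget : h q ∈ eh.target := hthick₄ hhqK₄
    -- `z := eh.symm (h q)` is within `ε₅` of `A (x', 0)`
    have hz : dist (eh.symm (h q)) (A (x', 0)) < ε₅ := by
      have h1 := hUC₅ (h q) hhqK₄ (eh (A (x', 0))) hcK₄
        (by rw [← hhc']; exact hdh.trans_le (min_le_right _ _))
      rwa [eh.left_inv (hCeh ⟨x', hx', rfl⟩)] at h1
    have hzK₁ : eh.symm (h q) ∈ K₁ := by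
      refine mem_cthickening_of_dist_le _ (A (x', 0)) _ _ ⟨x', hx', rfl⟩ ?_
      linarith [hz.trans_le (min_le_right δu (ρ₁ / 2))]
    have hzU₀ : eh.symm (h q) ∈ U₀ := hK₁U₀ hzK₁
    refine ⟨htarget, hzU₀, ?_⟩
    -- the sign of `z`
    by_contra hpos
    simp only [not_le] at hpos
    have hztu := hup_of x' hx' _ (hz.trans_le (min_le_left _ _)) hpos.le
    have h1 : h (eh.symm (h q)) = h q := by
      rw [hhku _ hzU₀.2 hztu, ← heh]; exact eh.right_inv htarget
    have h2 : eh.symm (h q) = q := hhinj hzU₀.2 hqO h1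
    rw [h2] at hpos
    linarith
  -- ### the charts `Θ`, `Θ'`
  set Θ : OpenPartialHomeomorph (E × ℝ) Q := AH.toOpenPartialHomeomorph.trans ef with hΘ_def
  set Θ' : OpenPartialHomeomorph (E × ℝ) Q := AH.toOpenPartialHomeomorph.trans eh with hΘ'_def
  have hΘapply : ∀ p, Θ p = fu (A p) := fun p => by
    simp only [hΘ_def, OpenPartialHomeomorph.coe_trans, comp_apply,
      Homeomorph.toOpenPartialHomeomorph_apply, hAHapply, hef]
  have hΘ'apply : ∀ p, Θ' p = ku (A p) := fun p => by
    simp only [hΘ'_def, OpenPartialHomeomorph.coe_trans, comp_apply,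
      Homeomorph.toOpenPartialHomeomorph_apply, hAHapply, heh]
  have hΘsource : ∀ p, p ∈ Θ.source ↔ A p ∈ ef.source := fun p => by
    simp [hΘ_def, hAHapply]
  have hΘ'source : ∀ p, p ∈ Θ'.source ↔ A p ∈ eh.source := fun p => by
    simp [hΘ'_def, hAHapply]
  have hΘ'symm : ∀ q, Θ'.symm q = AH.symm (eh.symm q) := fun q => by
    simp [hΘ'_def]
  have hΘsymm : ∀ q, Θ.symm q = AH.symm (ef.symm q) := fun q => by
    simp [hΘ_def]
  have hΘtarget : Θ.target = ef.target := by
    simp [hΘ_def]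
  have hΘ'target : Θ'.target = eh.target := by
    simp [hΘ'_def]
  -- ### the lower model and its globalisation
  set Glow₀ : E × ℝ → E × ℝ := fun p => AH.symm (eh.symm (kl (efl.symm (fu (A p))))) with hGlow₀
  set W₀ : Set (E × ℝ) :=
    {p | fu (A p) ∈ efl.target ∧ kl (efl.symm (fu (A p))) ∈ eh.target} with hW₀
  have hW₀o : IsOpen W₀ := by
    have h1 : IsOpen {p : E × ℝ | fu (A p) ∈ efl.target} :=
      efl.open_target.preimage (hfu.continuous.comp hAcont)
    have hc2 : ContinuousOn (fun p : E × ℝ => kl (efl.symm (fu (A p))))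
        {p : E × ℝ | fu (A p) ∈ efl.target} :=
      hkl.continuous.comp_continuousOn
        (efl.continuousOn_symm.comp (hfu.continuous.comp hAcont).continuousOn fun p hp => hp)
    exact hc2.isOpen_inter_preimage h1 eh.open_target
  have hGlow₀smooth : ContDiffOn ℝ ∞ Glow₀ W₀ := by
    have hA' : ContDiff ℝ ∞ A := by simp only [hA_def]; fun_prop
    have hAHs : ContDiff ℝ ∞ (AH.symm : Q → E × ℝ) := by
      have : (AH.symm : Q → E × ℝ) = fun q => Alin.symm (q - a₀) := by
        ext1 q; apply AH.injective; rw [AH.apply_symm_apply, hAHapply]; simp [hA_def]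
      rw [this]; fun_prop
    have h1 : ContDiffOn ℝ ∞ (fun p : E × ℝ => efl.symm (fu (A p)))
        {p : E × ℝ | fu (A p) ∈ efl.target} :=
      hefls.comp (hfu.comp hA').contDiffOn fun p hp => hp
    have h2 : ContDiffOn ℝ ∞ (fun p : E × ℝ => kl (efl.symm (fu (A p)))) W₀ :=
      hkl.comp_contDiffOn (h1.mono fun p hp => hp.1)
    have h3 : ContDiffOn ℝ ∞ (fun p : E × ℝ => eh.symm (kl (efl.symm (fu (A p))))) W₀ :=
      hehs.comp h2 fun p hp => hp.2
    exact hAHs.comp_contDiffOn h3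
  -- the compact lower box is inside `W₀`
  set CL : Set (E × ℝ) := KV ×ˢ Icc (-(δ₀ / 2)) 0 with hCL
  have hCLc : IsCompact CL := hKV.prod isCompact_Icc
  have hCLW₀ : CL ⊆ W₀ := by
    rintro ⟨x, σ⟩ ⟨hx, hσ1, hσ2⟩
    have hσ : |σ| < δ₀ := by rw [abs_lt]; constructor <;> linarith
    obtain ⟨q, hqN, hfq, hside, hqtl, hqs, hsymm, -, hhq, x', hx', hdq⟩ := hF5 x hx σ hσ hσ2
    obtain ⟨htarget, -, -⟩ := hF6 x' hx' q hqN hdq hside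
    refine ⟨?_, ?_⟩
    · show fu (A (x, σ)) ∈ efl.target
      rw [← hfq, hffl q (hN₀O hqN) hqtl, ← hefl]; exact efl.map_source hqs
    · show kl (efl.symm (fu (A (x, σ)))) ∈ eh.target
      rw [hsymm, ← hhq]; exact htarget
  obtain ⟨Glow, hGlow, V', hV'o, hCLV', hV'W₀, hGlowEq⟩ :=
    exists_contDiff_eqOn_of_isCompact_of_finiteDimensional hW₀o hGlow₀smooth hCLc hCLW₀
  -- ### the normal form
  set δ : ℝ := δ₀ / 2 with hδ_def
  have hδ0 : 0 < δ := by positivity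
  have hδδ₀ : δ < δ₀ := by rw [hδ_def]; linarith
  refine ⟨Θ, Θ', Glow, δ, ?_, ?_, ?_, ?_, ?_, hΘapply, hΘ'apply, fun p hp1 hp2 => ?box,
    fun p hp1 hp2 hp3 => ?upper, fun p hp1 hp2 => ?src, fun x hx => ?face⟩
  case face =>
    -- the chain of derivatives at the face point `p = (x, 0)`; all base points are `A (x, 0)`
    have hp3 : ((x, (0 : ℝ)) : E × ℝ).2 ≤ 0 := le_rfl
    have hσ : |((x, (0 : ℝ)) : E × ℝ).2| < δ₀ := by simpa using hδ₀0
    obtain ⟨q, hqN, hfq, hside, hqtl, hqs, hsymm, hu, hhq, x', hx', hdq⟩ := hF5 x hx 0 hσ hp3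
    obtain ⟨htarget, hzU₀, hzsign⟩ := hF6 x' hx' q hqN hdq hside
    have hpCL : ((x, (0 : ℝ)) : E × ℝ) ∈ CL := ⟨hx, by linarith, le_rfl⟩
    have hev : Glow =ᶠ[𝓝 ((x, (0 : ℝ)) : E × ℝ)] Glow₀ := by
      filter_upwards [hV'o.mem_nhds (hCLV' hpCL)] with p' hp' using hGlowEq hp'
    have hpU₀ := hF1 x hx 0 hσ
    -- `q = A (x, 0)`
    have hcore : A (x, 0) ∈ C := ⟨x, hx, rfl⟩
    have hqA : q = A (x, 0) := by
      refine hfinj (hN₀O hqN) (hCO hcore) ?_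
      rw [hfq, hffu _ (hCO hcore) (hCtu hcore)]
    obtain ⟨L₁, hL₁⟩ := hefd (A (x, 0)) hpU₀.1.1.1
    obtain ⟨L₂, hL₂, hL₂s⟩ := exists_hasFDerivAt_symm_equiv efl hefl hfl hefls hqs
    obtain ⟨L₃, hL₃⟩ := exists_continuousLinearEquiv_eq_of_injective (hDkl q hqtl)
    have hL₃' : HasFDerivAt kl (L₃ : Q →L[ℝ] Q) (efl.symm (fu (A (x, 0)))) := by
      rw [hsymm, hL₃]; exact (hkl.differentiable (by simp) q).hasFDerivAt
    have hzs : eh.symm (h q) ∈ eh.source := hzU₀.1.2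
    have hzA : eh.symm (h q) = A (x, 0) := by
      rw [hqA, hhku _ (hCO hcore) (hCtu hcore), ← heh]; exact eh.left_inv (hCeh hcore)
    obtain ⟨L₄, hL₄, hL₄s⟩ := exists_hasFDerivAt_symm_equiv eh heh hku hehs hzs
    have hL₄s' : HasFDerivAt eh.symm (L₄.symm : Q →L[ℝ] Q) (kl (efl.symm (fu (A (x, 0))))) := by
      have : ku (eh.symm (h q)) = kl (efl.symm (fu (A (x, 0)))) := by
        rw [← heh, eh.right_inv htarget, hhq, hsymm]
      rwa [this] at hL₄s
    have hflq : fl q = fu (A (x, 0)) := by rw [← hffl q (hN₀O hqN) hqtl, hfq]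
    have hL₂s' : HasFDerivAt efl.symm (L₂.symm : Q →L[ℝ] Q) (fu (A (x, 0))) := by
      rwa [hflq] at hL₂s
    have hc1 : HasFDerivAt (fun p' => fu (A p'))
        ((L₁ : Q →L[ℝ] Q).comp (Alin : (E × ℝ) →L[ℝ] Q)) (x, 0) := hL₁.comp (x, 0) (hAderiv (x, 0))
    have hc2 : HasFDerivAt (fun p' => efl.symm (fu (A p')))
        ((L₂.symm : Q →L[ℝ] Q).comp ((L₁ : Q →L[ℝ] Q).comp (Alin : (E × ℝ) →L[ℝ] Q))) (x, 0) :=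
      hL₂s'.comp (x, 0) hc1
    have hc3 : HasFDerivAt (fun p' => kl (efl.symm (fu (A p'))))
        ((L₃ : Q →L[ℝ] Q).comp ((L₂.symm : Q →L[ℝ] Q).comp
          ((L₁ : Q →L[ℝ] Q).comp (Alin : (E × ℝ) →L[ℝ] Q)))) (x, 0) :=
      hL₃'.comp (x, 0) hc2
    have hc4 : HasFDerivAt (fun p' => eh.symm (kl (efl.symm (fu (A p')))))
        ((L₄.symm : Q →L[ℝ] Q).comp ((L₃ : Q →L[ℝ] Q).comp ((L₂.symm : Q →L[ℝ] Q).comp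
          ((L₁ : Q →L[ℝ] Q).comp (Alin : (E × ℝ) →L[ℝ] Q))))) (x, 0) :=
      hL₄s'.comp (x, 0) hc3
    have hc5 : HasFDerivAt Glow₀
        ((Alin.symm : Q →L[ℝ] E × ℝ).comp ((L₄.symm : Q →L[ℝ] Q).comp ((L₃ : Q →L[ℝ] Q).comp
          ((L₂.symm : Q →L[ℝ] Q).comp ((L₁ : Q →L[ℝ] Q).comp
            (Alin : (E × ℝ) →L[ℝ] Q)))))) (x, 0) :=
      (hAsymm_deriv _).comp (x, 0) hc4
    refine ⟨L₁, L₂, L₃, L₄, ?_, ?_, ?_, ?_, hc5.congr_of_eventuallyEq hev⟩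
    · show (L₁ : Q →L[ℝ] Q) = fderiv ℝ fu (A (x, 0)); exact hL₁.fderiv.symm
    · show (L₂ : Q →L[ℝ] Q) = fderiv ℝ fl (A (x, 0)); rw [← hqA]; exact hL₂.fderiv.symm
    · show (L₃ : Q →L[ℝ] Q) = fderiv ℝ kl (A (x, 0)); rw [← hqA]; exact hL₃
    · show (L₄ : Q →L[ℝ] Q) = fderiv ℝ ku (A (x, 0)); rw [← hzA]; exact hL₄.fderiv.symm
  case src =>
    have h := hF1 p.1 hp1 p.2 (hp2.trans hδδ₀)
    exact ⟨(hΘsource p).2 h.1.1.1, (hΘ'source p).2 h.1.2⟩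
  case box =>
    refine ⟨(hF1 p.1 hp1 p.2 (hp2.trans hδδ₀)).2, ?_⟩
    obtain ⟨q, hqN, hfq, x', hx', hdq⟩ := hF2 p.1 hp1 p.2 (hp2.trans hδδ₀)
    refine ⟨q, hN₀O hqN, ?_, hfq⟩
    rcases le_total 0 (b.coord i₀ q) with h | h
    · exact Or.inl (hF3u x' hx' q hdq h)
    · exact Or.inr (hF3l x' hx' q hdq h)
  case upper =>
    have hσ : |p.2| < δ₀ := by rw [abs_of_nonneg hp2]; exact hp3.trans hδδ₀
    refine hup_of p.1 hp1 (A p) ?_ (by rw [hA p]; positivity)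
    have := hF1dist p.1 hp1 p.2 hσ
    linarith [min_le_right (min (ρ₁ / 2) ω₆) (min δu δl), min_le_left δu δl]
  · refine
      { isOpen := hVo
        pos := hδ0
        source := fun p hp1 hp2 => ?_
        source' := fun p hp1 hp2 => ?_
        up := fun p hp1 hp2 hp3 => ?_
        low_mem := fun p hp1 hp2 hp3 => ?_
        low := fun p hp1 hp2 hp3 => ?_
        injOn := ?_
        glow_contDiff := hGlow
        glow_deriv := fun p hp1 hp2 hp3 => ?_ }
    · -- source
      rw [hΘsource]; exact (hF1 p.1 (hVK hp1) p.2 (hp2.trans hδδ₀)).1.1.1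
    · -- source'
      rw [hΘ'source]; exact (hF1 p.1 (hVK hp1) p.2 (hp2.trans hδδ₀)).1.2
    · -- up
      have hσ : |p.2| < δ₀ := by rw [abs_of_nonneg hp2]; exact hp3.trans hδδ₀
      have hpU₀ := hF1 p.1 (hVK hp1) p.2 hσ
      have hptu : A p ∈ convexHull ℝ ((insert pu (facet b i₀) : Finset Q) : Set Q) := by
        refine hup_of p.1 (hVK hp1) (A p) ?_ (by rw [hA p]; positivity)
        have := hF1dist p.1 (hVK hp1) p.2 hσ
        linarith [min_le_right (min (ρ₁ / 2) ω₆) (min δu δl), min_le_left δu δl]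
      rw [hΘapply, hΘ'apply, ← hffu _ hpU₀.2 hptu, huf _ hpU₀.2, hhku _ hpU₀.2 hptu]
    · -- low_mem
      have hσ : |p.2| < δ₀ := by rw [abs_lt]; constructor <;> linarith
      obtain ⟨q, hqN, hfq, hside, hqtl, hqs, hsymm, hu, hhq, x', hx', hdq⟩ :=
        hF5 p.1 (hVK hp1) p.2 hσ hp3
      obtain ⟨htarget, hzU₀, hzsign⟩ := hF6 x' hx' q hqN hdq hside
      have hpCL : p ∈ CL := ⟨hVK hp1, by linarith, hp3⟩
      rw [hGlowEq (hCLV' hpCL)]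
      show AH.symm (eh.symm (kl (efl.symm (fu (A p))))) ∈ Θ'.source
      rw [hsymm, ← hhq, hΘ'source, hAHsymm]
      exact hzU₀.1.2
    · -- low
      have hσ : |p.2| < δ₀ := by rw [abs_lt]; constructor <;> linarith
      obtain ⟨q, hqN, hfq, hside, hqtl, hqs, hsymm, hu, hhq, x', hx', hdq⟩ :=
        hF5 p.1 (hVK hp1) p.2 hσ hp3
      obtain ⟨htarget, hzU₀, hzsign⟩ := hF6 x' hx' q hqN hdq hside
      have hpCL : p ∈ CL := ⟨hVK hp1, by linarith, hp3⟩
      rw [hGlowEq (hCLV' hpCL), hΘapply, hu]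
      show kl q = Θ' (AH.symm (eh.symm (kl (efl.symm (fu (A p))))))
      rw [hsymm, ← hhq, hΘ'apply, hAHsymm, ← heh, eh.right_inv htarget]
    · -- injOn
      rintro p₁ ⟨hp₁1, hp₁2⟩ p₂ ⟨hp₂1, hp₂2⟩ heq
      simp only at heq
      obtain ⟨q₁, hq₁N, hfq₁, -⟩ := hF2 p₁.1 (hVK hp₁1) p₁.2 (hp₁2.trans hδδ₀)
      obtain ⟨q₂, hq₂N, hfq₂, -⟩ := hF2 p₂.1 (hVK hp₂1) p₂.2 (hp₂2.trans hδδ₀)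
      rw [hΘapply, hΘapply] at heq
      have h1 : h q₁ = h q₂ := by
        rw [← huf q₁ (hN₀O hq₁N), ← huf q₂ (hN₀O hq₂N), hfq₁, hfq₂]
        exact heq
      have h2 : q₁ = q₂ := hhinj (hN₀O hq₁N) (hN₀O hq₂N) h1
      have h3 : fu (A p₁) = fu (A p₂) := by rw [← hfq₁, ← hfq₂, h2]
      have hs₁ : A p₁ ∈ ef.source := (hF1 p₁.1 (hVK hp₁1) p₁.2 (hp₁2.trans hδδ₀)).1.1.1
      have hs₂ : A p₂ ∈ ef.source := (hF1 p₂.1 (hVK hp₂1) p₂.2 (hp₂2.trans hδδ₀)).1.1.1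
      have h4 : A p₁ = A p₂ := ef.injOn hs₁ hs₂ (by rw [hef]; exact h3)
      exact AH.injective (by rw [hAHapply, hAHapply]; exact h4)
    · -- glow_deriv
      have hσ : |p.2| < δ₀ := by rw [abs_lt]; constructor <;> linarith
      obtain ⟨q, hqN, hfq, hside, hqtl, hqs, hsymm, hu, hhq, x', hx', hdq⟩ :=
        hF5 p.1 (hVK hp1) p.2 hσ hp3
      simp only [Prod.mk.eta] at hfq hsymm hu
      obtain ⟨htarget, hzU₀, hzsign⟩ := hF6 x' hx' q hqN hdq hside
      have hpCL : p ∈ CL := ⟨hVK hp1, by linarith, hp3⟩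
      -- `Glow = Glow₀` near `p`
      have hev : Glow =ᶠ[𝓝 p] Glow₀ := by
        filter_upwards [hV'o.mem_nhds (hCLV' hpCL)] with p' hp' using hGlowEq hp'
      -- the chain of derivatives
      have hpU₀ := hF1 p.1 (hVK hp1) p.2 hσ
      simp only [Prod.mk.eta] at hpU₀
      obtain ⟨L₁, hL₁⟩ := hefd (A p) hpU₀.1.1.1
      obtain ⟨L₂, hL₂, hL₂s⟩ := exists_hasFDerivAt_symm_equiv efl hefl hfl hefls hqs
      obtain ⟨L₃, hL₃⟩ := exists_continuousLinearEquiv_eq_of_injective (hDkl q hqtl)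
      have hL₃' : HasFDerivAt kl (L₃ : Q →L[ℝ] Q) (efl.symm (fu (A p))) := by
        rw [hsymm, hL₃]; exact (hkl.differentiable (by simp) q).hasFDerivAt
      have hzs : eh.symm (h q) ∈ eh.source := hzU₀.1.2
      obtain ⟨L₄, hL₄, hL₄s⟩ := exists_hasFDerivAt_symm_equiv eh heh hku hehs hzs
      have hL₄s' : HasFDerivAt eh.symm (L₄.symm : Q →L[ℝ] Q) (kl (efl.symm (fu (A p)))) := by
        have : ku (eh.symm (h q)) = kl (efl.symm (fu (A p))) := by
          rw [← heh, eh.right_inv htarget, hhq, hsymm]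
        rwa [this] at hL₄s
      have hflq : fl q = fu (A p) := by rw [← hffl q (hN₀O hqN) hqtl, hfq]
      have hL₂s' : HasFDerivAt efl.symm (L₂.symm : Q →L[ℝ] Q) (fu (A p)) := by
        rwa [hflq] at hL₂s
      -- compose
      have hc1 : HasFDerivAt (fun p' => fu (A p'))
          ((L₁ : Q →L[ℝ] Q).comp (Alin : (E × ℝ) →L[ℝ] Q)) p := hL₁.comp p (hAderiv p)
      have hc2 : HasFDerivAt (fun p' => efl.symm (fu (A p')))
          ((L₂.symm : Q →L[ℝ] Q).comp ((L₁ : Q →L[ℝ] Q).comp (Alin : (E × ℝ) →L[ℝ] Q))) p :=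
        hL₂s'.comp p hc1
      have hc3 : HasFDerivAt (fun p' => kl (efl.symm (fu (A p'))))
          ((L₃ : Q →L[ℝ] Q).comp ((L₂.symm : Q →L[ℝ] Q).comp
            ((L₁ : Q →L[ℝ] Q).comp (Alin : (E × ℝ) →L[ℝ] Q)))) p :=
        hL₃'.comp p hc2
      have hc4 : HasFDerivAt (fun p' => eh.symm (kl (efl.symm (fu (A p')))))
          ((L₄.symm : Q →L[ℝ] Q).comp ((L₃ : Q →L[ℝ] Q).comp ((L₂.symm : Q →L[ℝ] Q).comp
            ((L₁ : Q →L[ℝ] Q).comp (Alin : (E × ℝ) →L[ℝ] Q))))) p :=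
        hL₄s'.comp p hc3
      have hc5 : HasFDerivAt Glow₀
          ((Alin.symm : Q →L[ℝ] E × ℝ).comp ((L₄.symm : Q →L[ℝ] Q).comp ((L₃ : Q →L[ℝ] Q).comp
            ((L₂.symm : Q →L[ℝ] Q).comp ((L₁ : Q →L[ℝ] Q).comp
              (Alin : (E × ℝ) →L[ℝ] Q)))))) p :=
        (hAsymm_deriv _).comp p hc4
      refine ⟨((((Alin.trans L₁).trans L₂.symm).trans L₃).trans L₄.symm).trans Alin.symm, ?_⟩
      refine HasFDerivAt.congr_of_eventuallyEq ?_ hev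
      convert hc5 using 1
      exact ContinuousLinearMap.ext fun v => rfl
  · -- `Θ` smooth
    intro p _
    have : (Θ : E × ℝ → Q) = fun p => fu (A p) := funext hΘapply
    rw [this]
    exact ((hfu.comp (by simp only [hA_def]; fun_prop)).contDiffAt).contDiffWithinAt
  · -- `Θ.symm` smooth
    have hAHs : ContDiff ℝ ∞ (AH.symm : Q → E × ℝ) := by
      have : (AH.symm : Q → E × ℝ) = fun q => Alin.symm (q - a₀) := by
        ext1 q; apply AH.injective; rw [AH.apply_symm_apply, hAHapply]; simp [hA_def]
      rw [this]; fun_prop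
    have : (Θ.symm : Q → E × ℝ) = fun q => AH.symm (ef.symm q) := funext hΘsymm
    rw [this, hΘtarget]
    exact hAHs.comp_contDiffOn hefs
  · -- `Θ'` smooth
    intro p _
    have : (Θ' : E × ℝ → Q) = fun p => ku (A p) := funext hΘ'apply
    rw [this]
    exact ((hku.comp (by simp only [hA_def]; fun_prop)).contDiffAt).contDiffWithinAt
  · -- `Θ'.symm` smooth
    have hAHs : ContDiff ℝ ∞ (AH.symm : Q → E × ℝ) := by
      have : (AH.symm : Q → E × ℝ) = fun q => Alin.symm (q - a₀) := by
        ext1 q; apply AH.injective; rw [AH.apply_symm_apply, hAHapply]; simp [hA_def]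
      rw [this]; fun_prop
    have : (Θ'.symm : Q → E × ℝ) = fun q => AH.symm (eh.symm q) := funext hΘ'symm
    rw [this, hΘ'target]
    exact hAHs.comp_contDiffOn hehs

end Construction

end Literature.Topology.FourManifolds
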